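import Summits.MatrixMultiplication.OmegaCensus.STPPVosperTightStructure
import Summits.MatrixMultiplication.OmegaCensus.STPPVosperClash61Tools

/-!
# ω-census (abelian STPP census): the Vosper table law at a GENERAL PRIME order `p` (kernel)

HONEST FRAMING (pub-omega census; verbatim): lottery ticket; floor = certified bounds/negative ranges.
Census STRUCTURE (seat pub-omega-stpp-1 gen 29, 2026-08-28), family (b2).  The order-`61` theorem filters `STPPVosperTableLaw` / `STPPVosperTableRatio` restated
for an arbitrary prime `p` (the next prime fronts of the census are `67, 71, 73, 79, …`); the only order-specific input left is the finite `ℕ`-table, which a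
successor decides per `(p, n, m, r)` by `decide +kernel` exactly as in `STPPVosperTableKillsZ61.lean`.  Nothing here is progress on `ω`.

## Contents

* `val_add_nsmul_zmod`, `zmod_natMul_injOn` — positions of the terms of a progression in `ℤ/pℤ`;
* `dvd_card_filter_val_lt_prime` — PREFIX LAW: for a disjoint union `T` of `r`-runs inside the window `{0,…,n−1}` (`n + r ≤ p + 1`) and `x ∉ T`,
  `r ∣ #{y ∈ T : y.val < x.val}`;
* `card_filter_val_lt_of_union_prime` — complement count in a window;
* `val_mem_of_nat_table_prime` — from the `ℕ`-table for `(p, n, m, r)` with target `J` to `j.val ∈ J`;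
* `tight_ratio_val_mem_prime` — an N18-TIGHT block `i` (`a, b, z, L ≥ 2`, `z + b + vol + a + L = p + 2`) plus the table for
  `(n, m, b) = (vol + L + a − 1, L + a − 1, b)` with target `J` gives steps `e, e′` of `Aᵢ, Bᵢ` with `(e′⁻¹e).val ∈ J`;
* `no_isSTPP_of_tight_table_prime` — with target `J = {0, 1, p − 1}` the family does not exist (TPP word at `(i,i,i)`).

Proofs are those of the order-`61` files with `61` replaced by `p` (Vosper needs `p` prime; the window bookkeeping needs `n + b ≤ p + 1`, which is
`p + 2 − z ≤ p + 1`, i.e. `z ≥ 1`).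

References: A. G. Vosper, J. London Math. Soc. 31 (1956); M. B. Nathanson, *Additive Number Theory: Inverse Problems*, GTM 165, Thm 2.7; H. Cohn,
R. Kleinberg, B. Szegedy, C. Umans, FOCS 2005 (arXiv:math/0511460), Def. 5.1.
-/

open Finset
open scoped Pointwise

namespace Summit.MatrixMultiplication.OmegaCensus.CubeNB

open Literature.Computability.AlgebraicComplexity
open Literature.Combinatorics.Additive
open Summit.MatrixMultiplication.OmegaCensus.STPPKneser

variable {p : ℕ} [hp : Fact p.Prime]

/-! ## Positions in `ℤ/pℤ` -/

/-- Positions of the terms of a progression in `ℤ/pℤ`: `(t + i•j).val = (t.val + j.val·i) mod p`. [folklore] -/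
theorem val_add_nsmul_zmod (t j : ZMod p) (i : ℕ) : (t + i • j).val = (t.val + j.val * i) % p := by
  have h : t + i • j = ((t.val + j.val * i : ℕ) : ZMod p) := by
    push_cast
    rw [ZMod.natCast_zmod_val, ZMod.natCast_zmod_val, nsmul_eq_mul, mul_comm]
  rw [h, ZMod.val_natCast]

/-- `i ↦ t + i•j` is injective on `i < p` (`j ≠ 0` in `ℤ/pℤ`). [folklore] -/
theorem zmod_natMul_injOn {t j : ZMod p} (hj : j ≠ 0) {i i' : ℕ} (hi : i < p) (hi' : i' < p)
    (h : t + i • j = t + i' • j) : i = i' := by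
  have h1 : (i : ZMod p) * j = (i' : ZMod p) * j := by
    have := add_left_cancel h; simpa [nsmul_eq_mul] using this
  have h2 : (i : ZMod p) = (i' : ZMod p) := mul_right_cancel₀ hj h1
  have h3 := (ZMod.natCast_eq_natCast_iff' i i' p).1 h2
  rwa [Nat.mod_eq_of_lt hi, Nat.mod_eq_of_lt hi'] at h3

/-! ## The prefix law and the window count -/

/-- **Prefix law at prime order.**  `T = ⋃_{k ∈ s} {g k + i : i < r}` a union of PAIRWISE DISJOINT `r`-runs inside `{0,…,n−1} ⊆ ℤ/pℤ`, `n + r ≤ p + 1`: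
for every `x ∉ T`, `r ∣ #{y ∈ T : y.val < x.val}`. [folklore] -/
theorem dvd_card_filter_val_lt_prime {ι : Type*} (s : Finset ι) (g : ι → ZMod p) {n r : ℕ} (hnr : n + r ≤ p + 1)
    (hdisj : (s : Set ι).PairwiseDisjoint fun k => apFinset (g k) 1 r)
    (hsub : ∀ k ∈ s, apFinset (g k) 1 r ⊆ apFinset 0 1 n) (x : ZMod p)
    (hx : x ∉ s.biUnion fun k => apFinset (g k) 1 r) :
    r ∣ #((s.biUnion fun k => apFinset (g k) 1 r).filter fun y => y.val < x.val) := by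
  rcases Nat.eq_zero_or_pos r with rfl | hr
  · simp
  rw [Finset.filter_biUnion]
  have hdisj' : (s : Set ι).PairwiseDisjoint fun k => (apFinset (g k) 1 r).filter fun y => y.val < x.val :=
    hdisj.mono fun k => Finset.filter_subset _ _
  rw [Finset.card_biUnion hdisj']
  apply Finset.dvd_sum
  intro k hk
  have hn : n ≤ p := by omega
  have hgn : (g k).val < n :=
    (mem_apFinset_zero_one_iff hn).1 (hsub k hk (mem_apFinset.2 ⟨0, hr, by simp⟩))
  have hval : ∀ i, i < r → (g k + i • (1 : ZMod p)).val = (g k).val + i := by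
    intro i hi
    rw [val_add_nsmul_zmod, ZMod.val_one, one_mul, Nat.mod_eq_of_lt (by omega)]
  by_cases hlt : (g k).val < x.val
  · have hall : (apFinset (g k) 1 r).filter (fun y => y.val < x.val) = apFinset (g k) 1 r := by
      apply Finset.filter_true_of_mem
      intro y hy
      obtain ⟨i, hi, rfl⟩ := mem_apFinset.1 hy
      rw [hval i hi]
      by_contra hge
      rw [not_lt] at hge
      obtain ⟨i₀, hi₀⟩ : ∃ i₀, (g k).val + i₀ = x.val := ⟨x.val - (g k).val, by omega⟩
      have hi₀r : i₀ < r := by omega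
      have hxmem : x ∈ apFinset (g k) 1 r := by
        refine mem_apFinset.2 ⟨i₀, hi₀r, ZMod.val_injective p ?_⟩
        rw [hval i₀ hi₀r, hi₀]
      exact hx (Finset.mem_biUnion.2 ⟨k, hk, hxmem⟩)
    rw [hall, card_apFinset one_ne_zero (by omega)]
  · have hnone : (apFinset (g k) 1 r).filter (fun y => y.val < x.val) = ∅ := by
      apply Finset.filter_false_of_mem
      intro y hy
      obtain ⟨i, hi, rfl⟩ := mem_apFinset.1 hy
      rw [hval i hi]
      omega
    rw [hnone, Finset.card_empty]
    exact dvd_zero r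

/-- **Complement count in a window of `ℤ/pℤ`.**  If `T ⊔ S = {0,…,n−1}` (`n ≤ p`) and `x.val ≤ n`, then
`#{y ∈ T : y.val < x.val} = x.val − #{y ∈ S : y.val < x.val}` and `#{y ∈ S : y.val < x.val} ≤ x.val`. [folklore] -/
theorem card_filter_val_lt_of_union_prime {n : ℕ} (hn : n ≤ p) {T S : Finset (ZMod p)} (hU : T ∪ S = apFinset 0 1 n)
    (hTS : Disjoint T S) {x : ZMod p} (hx : x.val ≤ n) :
    #(S.filter fun y => y.val < x.val) ≤ x.val ∧
      #(T.filter fun y => y.val < x.val) = x.val - #(S.filter fun y => y.val < x.val) := by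
  have hV : #((apFinset (0 : ZMod p) 1 n).filter fun y => y.val < x.val) = x.val :=
    card_filter_apFinset_zero_one hn hx
  have hsplit : (apFinset (0 : ZMod p) 1 n).filter (fun y => y.val < x.val) =
      T.filter (fun y => y.val < x.val) ∪ S.filter (fun y => y.val < x.val) := by
    rw [← hU, Finset.filter_union]
  have hdisj : Disjoint (T.filter fun y => y.val < x.val) (S.filter fun y => y.val < x.val) :=
    Finset.disjoint_filter_filter hTS
  have hsum := Finset.card_union_of_disjoint hdisj
  rw [← hsplit, hV] at hsum
  omega

/-! ## From an `ℕ`-table to `ℤ/pℤ` -/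

/-- **Table wrapper at prime order.**  Given the `ℕ`-table for `(p, n, m, r)` with target `J`: if the `m`-term progression `S = {t + i•j : i < m}` (`j ≠ 0`,
`m ≤ p`) lies in `{0,…,n−1}` (`n ≤ p`) and `r ∣ x.val − #{y ∈ S : y.val < x.val}` at every `x ∈ S`, then `j.val ∈ J`. [folklore] -/
theorem val_mem_of_nat_table_prime {n m r : ℕ} {J : Finset ℕ} (hn : n ≤ p) (hm : m ≤ p)
    (htable : ∀ j < p, ∀ t < p, (∀ i < m, (t + j * i) % p < n) →
      (∀ k < m, r ∣ (t + j * k) % p - #((range m).filter fun i => (t + j * i) % p < (t + j * k) % p)) → j ∈ J)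
    {t j : ZMod p} (hj : j ≠ 0) (hSV : apFinset t j m ⊆ apFinset 0 1 n)
    (hgap : ∀ x ∈ apFinset t j m, r ∣ x.val - #((apFinset t j m).filter fun y => y.val < x.val)) : j.val ∈ J := by
  have hpos : ∀ i, i < m → (t.val + j.val * i) % p < n := by
    intro i hi
    rw [← val_add_nsmul_zmod]
    exact (mem_apFinset_zero_one_iff hn).1 (hSV (mem_apFinset.2 ⟨i, hi, rfl⟩))
  have hcount : ∀ c : ℕ, #((apFinset t j m).filter fun y => y.val < c) =
      #((range m).filter fun i => (t.val + j.val * i) % p < c) := by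
    intro c
    have himg : apFinset t j m = (range m).image fun i : ℕ => t + i • j := rfl
    rw [himg, Finset.filter_image, Finset.card_image_of_injOn]
    · apply congrArg Finset.card
      apply Finset.filter_congr
      intro i _
      rw [val_add_nsmul_zmod]
    · intro i hi i' hi' h
      have him := Finset.mem_range.1 (Finset.mem_filter.1 (Finset.mem_coe.1 hi)).1
      have him' := Finset.mem_range.1 (Finset.mem_filter.1 (Finset.mem_coe.1 hi')).1
      exact zmod_natMul_injOn hj (by omega) (by omega) h
  have hgap' : ∀ k, k < m → r ∣ (t.val + j.val * k) % p -
      #((range m).filter fun i => (t.val + j.val * i) % p < (t.val + j.val * k) % p) := by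
    intro k hk
    have h := hgap (t + k • j) (mem_apFinset.2 ⟨k, hk, rfl⟩)
    rwa [hcount, val_add_nsmul_zmod] at h
  exact htable j.val (ZMod.val_lt j) t.val (ZMod.val_lt t) hpos hgap'

/-! ## The tight ratio lemma and the table law at prime order -/

/-- **Tight ratio lemma at prime order.**  See the module docstring; `hm : L + a = m + 1`, `hn : vol + m = n`, tightness `z + b + vol + a + L = p + 2`.
[cite: CohnKleinbergSzegedyUmans2005, Def. 5.1] [cite: Vosper1956, main theorem; Nathanson1996, Thm 2.7] -/
theorem tight_ratio_val_mem_prime {N : ℕ} (A B C : Fin N → Finset (ZMod p)) (hS : IsSTPP A B C)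
    (hA : ∀ k, (A k).Nonempty) (hB : ∀ k, (B k).Nonempty) (hC : ∀ k, (C k).Nonempty)
    (i : Fin N) (hI : ((univ : Finset (Fin N)).erase i).Nonempty)
    {a b vol z L m n : ℕ} (ha : #(A i) = a) (hb : #(B i) = b) (hvol : #(A i) * #(B i) * #(C i) = vol)
    (hz : ∑ k ∈ univ.erase i, #(A k) * #(C k) = z) (hL : ∑ k ∈ univ.erase i, #(B k) * #(C k) = L)
    (h2a : 2 ≤ a) (h2b : 2 ≤ b) (h2z : 2 ≤ z) (h2L : 2 ≤ L) (htight : z + b + vol + a + L = p + 2)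
    (hm : L + a = m + 1) (hn : vol + m = n) {J : Finset ℕ}
    (htable : ∀ j < p, ∀ t < p, (∀ i' < m, (t + j * i') % p < n) →
      (∀ k < m, b ∣ (t + j * k) % p - #((range m).filter fun i' => (t + j * i') % p < (t + j * k) % p)) → j ∈ J) :
    ∃ e e' α β : ZMod p, e ≠ 0 ∧ e' ≠ 0 ∧ A i = apFinset α e a ∧ B i = apFinset β e' b ∧ (e'⁻¹ * e).val ∈ J := by
  obtain ⟨a', rfl⟩ : ∃ a', a = a' + 1 := ⟨a - 1, by omega⟩
  obtain ⟨b', rfl⟩ : ∃ b', b = b' + 1 := ⟨b - 1, by omega⟩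
  -- Step 0: Vosper structure at the tight block
  obtain ⟨⟨e, he, hAap, hYap⟩, ⟨e', he', hBap, -, hVap, -, hEq⟩⟩ := vosper_structure_of_n18_tight_V hS hA hB hC i hI
    (by rw [ha]; omega) (by rw [hb]; omega) (by rw [hL]; exact h2L) (by rw [hz]; exact h2z) (by rw [hz, hL, hvol, ha, hb]; omega)
  set W := ((A i) ×ˢ ((B i) ×ˢ (C i))).image fun q : ZMod p × ZMod p × ZMod p => (0 : ZMod p) + q.2.2 - q.1 - q.2.1 with hW
  set Sn := (A i).image (fun x => (0 : ZMod p) - x) with hSn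
  set Yo := DU B C (univ.erase i) with hYo
  have hWcard : #W = vol := by rw [hW, card_image_blockSum hS i 0, hvol]
  have hWV : Disjoint W (Sn + Yo) := disjoint_W_negA_add_DU hS i
  have hYocard : #Yo = L := by rw [hYo, card_DU_BC hS hA, hL]
  obtain ⟨α, hα⟩ := hAap
  obtain ⟨β, hβ⟩ := hBap
  obtain ⟨y₀, hy⟩ := hYap
  obtain ⟨v, hv⟩ := hVap
  rw [ha] at hα; rw [hb] at hβ; rw [hYocard] at hy
  -- counting: |V| = n and Y° − Aᵢ is an m-progression of step e
  have hSna : Sn = apFinset (0 - α - a' • e) e (a' + 1) := by rw [hSn, hα, image_sub_apFinset]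
  have hsubm : Sn + Yo ⊆ apFinset (0 - α - a' • e + y₀) e m := by
    have h := apFinset_add_apFinset_subset (0 - α - a' • e) y₀ e (a' + 1) L
    rw [show a' + 1 + L - 1 = m by omega] at h
    rwa [hSna, hy]
  have hlem : #(Sn + Yo) ≤ m := (Finset.card_le_card hsubm).trans (card_apFinset_le _ _ _)
  have hZcard : #(DU A C (univ.erase i)) = z := by rw [card_DU_AC hS hB, hz]
  have hU : #(univ \ DU A C ((univ : Finset (Fin N)).erase i)) = p - z := by
    rw [Finset.card_sdiff_of_subset (Finset.subset_univ _), Finset.card_univ, ZMod.card, hZcard]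
  have hBV : #(B i + (W ∪ (Sn + Yo))) ≤ (b' + 1) + #(W ∪ (Sn + Yo)) - 1 := by
    have h := (Finset.card_le_card (apFinset_add_apFinset_subset β v e' (b' + 1) #(W ∪ (Sn + Yo)))).trans
      (card_apFinset_le _ _ _)
    rwa [← hβ, ← hv] at h
  rw [hEq, hU] at hBV
  have hVcard : #(W ∪ (Sn + Yo)) = #W + #(Sn + Yo) := Finset.card_union_of_disjoint hWV
  have hSYcard : #(Sn + Yo) = m := by omega
  have hVn : #(W ∪ (Sn + Yo)) = n := by omega
  have hnp : n ≤ p := by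
    have h := Finset.card_le_univ (W ∪ (Sn + Yo))
    rwa [hVn, ZMod.card] at h
  have hSY : Sn + Yo = apFinset (0 - α - a' • e + y₀) e m :=
    Finset.eq_of_subset_of_card_le hsubm (by rw [hSYcard, card_apFinset he (by omega)])
  rw [hVn] at hv
  rw [hSY] at hWV hv
  -- Step 1: W is the union of the blocks (c − x) − Bᵢ, pairwise disjoint by the TPP of block i
  set P := (A i) ×ˢ (C i) with hP
  have hblk : ∀ xc : ZMod p × ZMod p,
      (B i).image (fun y => (xc.2 - xc.1) - y) = apFinset (xc.2 - xc.1 - β - b' • e') e' (b' + 1) := by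
    intro xc; rw [hβ, image_sub_apFinset]
  have hWeq : W = P.biUnion fun xc => apFinset (xc.2 - xc.1 - β - b' • e') e' (b' + 1) := by
    ext x
    simp only [hW, hP, Finset.mem_image, Finset.mem_product, Finset.mem_biUnion, Prod.exists]
    constructor
    · rintro ⟨x₁, y, c, ⟨hx₁, hy', hc⟩, rfl⟩
      refine ⟨x₁, c, ⟨hx₁, hc⟩, ?_⟩
      rw [← hblk (x₁, c)]
      exact Finset.mem_image.2 ⟨y, hy', by abel⟩
    · rintro ⟨x₁, c, ⟨hx₁, hc⟩, hx⟩
      rw [← hblk (x₁, c)] at hx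
      obtain ⟨y, hy', rfl⟩ := Finset.mem_image.1 hx
      exact ⟨x₁, y, c, ⟨hx₁, hy', hc⟩, by abel⟩
  have hPdisj : (P : Set (ZMod p × ZMod p)).PairwiseDisjoint fun xc => apFinset (xc.2 - xc.1 - β - b' • e') e' (b' + 1) := by
    rintro ⟨x₁, c⟩ hxc ⟨x₁', c'⟩ hxc' hne
    rw [Function.onFun, ← hblk, ← hblk, Finset.disjoint_left]
    intro x hx hx'
    obtain ⟨y, hy', rfl⟩ := Finset.mem_image.1 hx
    obtain ⟨y', hy'', hyy⟩ := Finset.mem_image.1 hx'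
    have h1 := Finset.mem_product.1 (Finset.mem_coe.1 hxc)
    have h2 := Finset.mem_product.1 (Finset.mem_coe.1 hxc')
    have hrel : (x₁' - x₁) + (y' - y) + (c - c') = 0 := by
      have h : c' - x₁' - y' = c - x₁ - y := hyy
      linear_combination (-1 : ZMod p) * h
    obtain ⟨-, -, h3, -, h5⟩ := hS i i i x₁ h1.1 x₁' h2.1 y hy' y' hy'' c' h2.2 c h1.2 hrel
    exact hne (Prod.ext h3 h5.symm)
  -- Step 2: transport by φ(x) = u·x + w, u = e′⁻¹, w = −u·v
  obtain ⟨u, hu⟩ : ∃ u : ZMod p, u = e'⁻¹ := ⟨_, rfl⟩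
  have hu0 : u ≠ 0 := by rw [hu]; exact inv_ne_zero he'
  have hue : u * e' = 1 := by rw [hu]; exact inv_mul_cancel₀ he'
  obtain ⟨w, hw⟩ : ∃ w : ZMod p, w = -(u * v) := ⟨_, rfl⟩
  have hφinj : Function.Injective (fun x : ZMod p => u * x + w) := affine_injective hu0 w
  have hφV : (apFinset v e' n).image (fun x => u * x + w) = apFinset 0 1 n := by
    rw [image_affine_apFinset, hue, hw, add_neg_cancel]
  set g : ZMod p × ZMod p → ZMod p := fun xc => u * (xc.2 - xc.1 - β - b' • e') + w with hg
  have hφblk : ∀ xc : ZMod p × ZMod p,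
      (apFinset (xc.2 - xc.1 - β - b' • e') e' (b' + 1)).image (fun x => u * x + w) = apFinset (g xc) 1 (b' + 1) := by
    intro xc; rw [image_affine_apFinset, hue]
  set T := W.image (fun x => u * x + w) with hT
  have hTeq : T = P.biUnion fun xc => apFinset (g xc) 1 (b' + 1) := by
    rw [hT, hWeq, Finset.biUnion_image]
    exact Finset.biUnion_congr rfl fun xc _ => hφblk xc
  have hTdisj : (P : Set (ZMod p × ZMod p)).PairwiseDisjoint fun xc => apFinset (g xc) 1 (b' + 1) := by
    intro xc hxc xc' hxc' hne
    rw [Function.onFun, ← hφblk, ← hφblk]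
    exact (Finset.disjoint_image hφinj).2 (hPdisj hxc hxc' hne)
  set S := (apFinset (0 - α - a' • e + y₀) e m).image (fun x => u * x + w) with hSdef
  have hSeq : S = apFinset (u * (0 - α - a' • e + y₀) + w) (u * e) m := by rw [hSdef, image_affine_apFinset]
  have hTS : T ∪ S = apFinset 0 1 n := by rw [hT, hSdef, ← Finset.image_union, hv, hφV]
  have hTSdisj : Disjoint T S := by rw [hT, hSdef]; exact (Finset.disjoint_image hφinj).2 hWV
  have hTsub : ∀ xc ∈ P, apFinset (g xc) 1 (b' + 1) ⊆ apFinset 0 1 n := by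
    intro xc hxc y hy'
    rw [← hTS, hTeq]
    exact Finset.mem_union_left _ (Finset.mem_biUnion.2 ⟨xc, hxc, hy'⟩)
  have hSsub : S ⊆ apFinset 0 1 n := by rw [← hTS]; exact Finset.subset_union_right
  -- Step 3: prefix law at the points of S, and the table
  have hj0 : u * e ≠ 0 := mul_ne_zero hu0 he
  have hgap : ∀ x ∈ S, (b' + 1) ∣ x.val - #(S.filter fun y => y.val < x.val) := by
    intro x hxS
    have hxT : x ∉ T := fun hxT => Finset.disjoint_left.1 hTSdisj hxT hxS
    have hxle : x.val ≤ n := ((mem_apFinset_zero_one_iff hnp).1 (hSsub hxS)).le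
    have h4 : (b' + 1) ∣ #(T.filter fun y => y.val < x.val) := by
      rw [hTeq]
      exact dvd_card_filter_val_lt_prime P g (by omega) hTdisj hTsub x (by rw [← hTeq]; exact hxT)
    rw [(card_filter_val_lt_of_union_prime hnp hTS hTSdisj hxle).2] at h4
    exact h4
  rw [hSeq] at hgap hSsub
  have hval := val_mem_of_nat_table_prime hnp (by omega) htable hj0 hSsub hgap
  rw [hu] at hval
  exact ⟨e, e', α, β, he, he', hα, hβ, hval⟩

/-- **The Vosper table law at prime order (kernel, general block).**  With the table target `{0, 1, p − 1}` the family does not exist.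
[cite: CohnKleinbergSzegedyUmans2005, Def. 5.1] [cite: Vosper1956, main theorem; Nathanson1996, Thm 2.7] -/
theorem no_isSTPP_of_tight_table_prime {N : ℕ} (A B C : Fin N → Finset (ZMod p)) (hS : IsSTPP A B C)
    (hA : ∀ k, (A k).Nonempty) (hB : ∀ k, (B k).Nonempty) (hC : ∀ k, (C k).Nonempty)
    (i : Fin N) (hI : ((univ : Finset (Fin N)).erase i).Nonempty)
    {a b vol z L m n : ℕ} (ha : #(A i) = a) (hb : #(B i) = b) (hvol : #(A i) * #(B i) * #(C i) = vol)
    (hz : ∑ k ∈ univ.erase i, #(A k) * #(C k) = z) (hL : ∑ k ∈ univ.erase i, #(B k) * #(C k) = L)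
    (h2a : 2 ≤ a) (h2b : 2 ≤ b) (h2z : 2 ≤ z) (h2L : 2 ≤ L) (htight : z + b + vol + a + L = p + 2)
    (hm : L + a = m + 1) (hn : vol + m = n)
    (htable : ∀ j < p, ∀ t < p, (∀ i' < m, (t + j * i') % p < n) →
      (∀ k < m, b ∣ (t + j * k) % p - #((range m).filter fun i' => (t + j * i') % p < (t + j * k) % p)) →
      j ∈ ({0, 1, p - 1} : Finset ℕ)) : False := by
  obtain ⟨e, e', α, β, he, he', hα, hβ, hval⟩ := tight_ratio_val_mem_prime A B C hS hA hB hC i hI ha hb hvol hz hL h2a h2b h2z h2L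
    htight hm hn htable
  have hp1 : ((p - 1 : ℕ) : ZMod p) = -1 := by
    rw [Nat.cast_sub hp.out.one_le, Nat.cast_one, ZMod.natCast_self, zero_sub]
  -- e = ±e′
  have hpm : e = e' ∨ e = -e' := by
    have hee : e' * (e'⁻¹ * e) = e := by rw [← mul_assoc, mul_inv_cancel₀ he', one_mul]
    simp only [Finset.mem_insert, Finset.mem_singleton] at hval
    rcases hval with h0 | h1 | h60'
    · exact absurd ((ZMod.val_eq_zero _).1 h0) (mul_ne_zero (inv_ne_zero he') he)
    · left
      have h : (((e'⁻¹ * e).val : ℕ) : ZMod p) = ((1 : ℕ) : ZMod p) := by rw [h1]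
      rw [ZMod.natCast_zmod_val, Nat.cast_one] at h
      rw [← hee, h, mul_one]
    · right
      have h : (((e'⁻¹ * e).val : ℕ) : ZMod p) = ((p - 1 : ℕ) : ZMod p) := by rw [h60']
      rw [ZMod.natCast_zmod_val, hp1] at h
      rw [← hee, h, mul_neg, mul_one]
  -- the TPP of block i fails
  obtain ⟨a', rfl⟩ : ∃ a', a = a' + 1 := ⟨a - 1, by omega⟩
  obtain ⟨b', rfl⟩ : ∃ b', b = b' + 1 := ⟨b - 1, by omega⟩
  obtain ⟨γ, hγ⟩ := hC i
  have hαmem : α ∈ A i := by rw [hα]; exact mem_apFinset.2 ⟨0, by omega, by simp⟩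
  have hαe : α + e ∈ A i := by rw [hα]; exact mem_apFinset.2 ⟨1, by omega, by simp⟩
  have hβmem : β ∈ B i := by rw [hβ]; exact mem_apFinset.2 ⟨0, by omega, by simp⟩
  have hβe : β + e' ∈ B i := by rw [hβ]; exact mem_apFinset.2 ⟨1, by omega, by simp⟩
  rcases hpm with h | h
  · have hrel : (α - (α + e)) + ((β + e') - β) + (γ - γ) = 0 := by rw [h]; ring
    obtain ⟨-, -, -, h4, -⟩ := hS i i i (α + e) hαe α hαmem β hβmem (β + e') hβe γ hγ γ hγ hrel
    exact he' (by linear_combination h4.symm)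
  · have hrel : ((α + e) - α) + ((β + e') - β) + (γ - γ) = 0 := by rw [h]; ring
    obtain ⟨-, -, -, h4, -⟩ := hS i i i α hαmem (α + e) hαe β hβmem (β + e') hβe γ hγ γ hγ hrel
    exact he' (by linear_combination h4.symm)

end Summit.MatrixMultiplication.OmegaCensus.CubeNB
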